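import Summits.QuantumAdvantage.QuantumAdvantage.Theorems.RandomOracleGaugeDecoupledCoreAAL1FamilyEquiv
import Summits.QuantumAdvantage.QuantumAdvantage.Theorems.RandomOracleGaugeDecoupledCoreAAL1FamilyAddress
import Summits.QuantumAdvantage.QuantumAdvantage.Theorems.SosSandwichPseudoBoundedAABooleanCorner
import HarnessLib

/-!
# Crux `DecoupledCoreAA` (stmt-QuantumAdvantage-17872), line `l1-family`, stub `stub_l1Family` —
# the BOOLEAN CORNER: signed-partition families satisfy the dichotomy at POLYNOMIAL scale (`1/(256 d³)`)

The decoupled polynomial `q(y,z) = 1/2 + (1/2)Σ_i (±1)^{y_i} g_i(z)` of an ℓ¹-family is `{0,1}`-VALUED exactly when the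
family is a SIGNED PARTITION of the cube: at every `z` exactly one member takes a value `±1` and all others vanish
(then `Σ_i |g_i| ≡ 1` and the total mass is `V = 1`).  The line card's ADDRESS FAMILY (`g_t = 1[addr = t]`,
`…L1FamilyAddress`) is of this kind — its `q` is the address function.  For such families the open stub holds with a
POLYNOMIAL rate, by the known Boolean case of the Aaronson–Ambainis conjecture (O'Donnell–Saks–Schramm–Servedio +
Midrijanis + Nisan–Szegedy, in the tree as `BooleanCorner.exists_influence_ge_of_boolean`):

* §1 `pseudoBounded_of_boolean` — a `{0,1}`-valued polynomial of total degree `≤ T` lies in `K_T` (one-term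
  certificates `p = p²`, `1 − p = (1 − p)²`); `sum_abs_eq_one_of_signedPartition`, `sum_sq_eq_one_of_signedPartition`.
* §2 `l1Family_signedPartition` — **for a signed-partition family of degree `≤ d` (`d ≥ 1`):
  `(∃ i, E[g_i²] ≥ 1/(256 d³)) ∨ (∃ j, Σ_i E[(g_i − g_i^{⊕j})²] ≥ 1/(64 d³))`** (`q ∈ K_{d+1}` Boolean, `Var q = 1/4`,
  OSSS: `maxInf q ≥ 1/(32 (d+1)³)`; a `y`-variable is alternative (A), a `z`-variable is (B), by `stub_derivativeFamily`).
* §3 `l1Family_of_signedPartition` — the REGISTERED statement of `stub_l1Family` with the extra hypothesis "signed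
  partition", for every regime, with `(c, C) = (3, 1/256)`.

So the dichotomy is known exactly on the corner where the address family lives; what remains open is the
non-Boolean bulk (members with intermediate values), as for AA itself.  Honest label: a known special case (Boolean AA)
transported to the stub's vocabulary; no stub, crux or summit is closed.  Sources: O'Donnell–Saks–Schramm–Servedio
2005 Thm 1.1; Midrijanis 2004; Nisan–Szegedy 1994; O'Donnell–Zhao arXiv:1512.01603 eqn. (2.1); Aaronson–Ambainis
arXiv:0911.0996 Conj. 6 / Thm. 1.9 (Boolean case).
-/

-- D-0017: single-conjunct summit ⇒ the duplicate `QuantumAdvantage.QuantumAdvantage` is mandated.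
set_option linter.dupNamespace false

noncomputable section

open Finset
open Literature.Computability.QuantumComplexity
open Summit.QuantumAdvantage.QuantumAdvantage.Cruxes.DecoupledCoreAA.L1Family.Equiv
  (evalBool_decoupledOf totalDegree_decoupledOf_le decoupledOf_bounded boolAvg_half_sq)
open Summit.QuantumAdvantage.QuantumAdvantage.Cruxes.DecoupledCoreAA.L1Family.Address (sum_boolAvg_eq)
open Summit.QuantumAdvantage.QuantumAdvantage.Theorems.SosSandwich.BooleanCorner (exists_influence_ge_of_boolean)

namespace Summit.QuantumAdvantage.QuantumAdvantage.Cruxes.DecoupledCoreAA.L1Family.BooleanCorner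

variable {N : ℕ}

/-! ### §1 Boolean polynomials are pseudo-bounded; signed partitions -/

/-- **A `{0,1}`-valued polynomial of total degree `≤ T` is pseudo-bounded of order `T`** (one-term certificates
`p = p²`, `1 − p = (1 − p)²` on the cube). [cite: KaniewskiLeeDewolf2015, Def. 7] -/
theorem pseudoBounded_of_boolean {p : MvPolynomial (Fin N) ℝ} {T : ℕ} (hdeg : p.totalDegree ≤ T)
    (h01 : ∀ x, evalBool p x = 0 ∨ evalBool p x = 1) : PseudoBounded T p := by
  refine ⟨1, fun _ => p, fun _ => 1 - p, fun _ => ⟨hdeg, ?_⟩, fun x => ⟨?_, ?_⟩⟩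
  · refine (MvPolynomial.totalDegree_sub _ _).trans (max_le ?_ hdeg)
    rw [MvPolynomial.totalDegree_one]; exact Nat.zero_le _
  · rw [Fin.sum_univ_one]
    change evalBool p x = evalBool p x ^ 2
    rcases h01 x with h | h <;> rw [h] <;> norm_num
  · rw [Fin.sum_univ_one]
    change 1 - evalBool p x = evalBool (1 - p) x ^ 2
    have e : evalBool (1 - p) x = 1 - evalBool p x := by unfold evalBool; rw [map_sub, map_one]
    rw [e]
    rcases h01 x with h | h <;> rw [h] <;> norm_num

/-- In a signed-partition family the pointwise ℓ¹-mass is exactly `1`. [folklore] -/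
theorem sum_abs_eq_one_of_signedPartition {ι : Type*} [Fintype ι] [DecidableEq ι] (g : ι → MvPolynomial (Fin N) ℝ)
    (hpart : ∀ z, ∃ i, |evalBool (g i) z| = 1 ∧ ∀ k, k ≠ i → evalBool (g k) z = 0) (z : Fin N → Bool) :
    ∑ i, |evalBool (g i) z| = 1 := by
  obtain ⟨i, hi, hk⟩ := hpart z
  rw [Finset.sum_eq_single i (fun k _ hki => by rw [hk k hki, abs_zero]) (fun h => absurd (Finset.mem_univ i) h)]
  exact hi

/-- In a signed-partition family the pointwise sum of squares is exactly `1`. [folklore] -/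
theorem sum_sq_eq_one_of_signedPartition {ι : Type*} [Fintype ι] [DecidableEq ι] (g : ι → MvPolynomial (Fin N) ℝ)
    (hpart : ∀ z, ∃ i, |evalBool (g i) z| = 1 ∧ ∀ k, k ≠ i → evalBool (g k) z = 0) (z : Fin N → Bool) :
    ∑ i, evalBool (g i) z ^ 2 = 1 := by
  obtain ⟨i, hi, hk⟩ := hpart z
  rw [Finset.sum_eq_single i (fun k _ hki => by rw [hk k hki]; ring) (fun h => absurd (Finset.mem_univ i) h),
    ← sq_abs, hi, one_pow]

/-- In a signed-partition family the signed sum `Σ_i (±1)^{y_i} g_i(z)/2` is `± 1/2`. [folklore] -/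
theorem sum_sign_mul_half_sq {ι : Type*} [Fintype ι] [DecidableEq ι] (g : ι → MvPolynomial (Fin N) ℝ)
    (hpart : ∀ z, ∃ i, |evalBool (g i) z| = 1 ∧ ∀ k, k ≠ i → evalBool (g k) z = 0)
    (y : ι → Bool) (z : Fin N → Bool) :
    (∑ i, (if y i then (1 : ℝ) else -1) * (1 / 2 * evalBool (g i) z)) ^ 2 = 1 / 4 := by
  obtain ⟨i, hi, hk⟩ := hpart z
  rw [Finset.sum_eq_single i (fun k _ hki => by rw [hk k hki]; ring) (fun h => absurd (Finset.mem_univ i) h)]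
  have hsq : evalBool (g i) z ^ 2 = 1 := by rw [← sq_abs, hi, one_pow]
  have hs : (if y i then (1 : ℝ) else -1) ^ 2 = 1 := by split_ifs <;> norm_num
  calc ((if y i then (1 : ℝ) else -1) * (1 / 2 * evalBool (g i) z)) ^ 2
      = (if y i then (1 : ℝ) else -1) ^ 2 * (1 / 4) * evalBool (g i) z ^ 2 := by ring
    _ = 1 / 4 := by rw [hs, hsq]; ring

/-! ### §2 The dichotomy for signed-partition families, at polynomial scale -/

/-- **Boolean corner of `stub_l1Family`.**  Let `g : Fin N → ℝ[x_1..x_N]` have total degrees `≤ d` (`d ≥ 1`) and be a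
SIGNED PARTITION of the cube (at every `z` exactly one `|g_i(z)| = 1`, all other `g_k(z) = 0`).  Then
`(∃ i, E[g_i²] ≥ 1/(256 d³)) ∨ (∃ j, Σ_i E[(g_i − g_i^{⊕j})²] ≥ 1/(64 d³))`.
Proof: the decoupled `q = 1/2 + Σ_i (x_{y_i} − 1/2) g_i(z)` is `{0,1}`-valued of degree `≤ d+1`, hence in `K_{d+1}`,
with `Var q = 1/4`; the tree's Boolean corner (OSSS + Midrijanis + Nisan–Szegedy) gives a variable with
`Inf ≥ 1/(32 (d+1)³) ≥ 1/(256 d³)`; `Inf_{y_i} q = E[g_i²]`, `Inf_{z_j} q = ¼ Σ_i E[(g_i − g_i^{⊕j})²]`.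
[cite: OdonnellEtAl2005, Thm 1.1] [cite: Midrijanis2004, Thm 4] [cite: ODonnellZhao2016, eqn. (2.1)] -/
theorem l1Family_signedPartition {N d : ℕ} (g : Fin N → MvPolynomial (Fin N) ℝ) (hd : 1 ≤ d)
    (hdeg : ∀ i, (g i).totalDegree ≤ d)
    (hpart : ∀ z, ∃ i, |evalBool (g i) z| = 1 ∧ ∀ k, k ≠ i → evalBool (g k) z = 0) :
    (∃ i, 1 / (256 * (d : ℝ) ^ 3) ≤ boolAvg (fun z => evalBool (g i) z ^ 2)) ∨
    (∃ j, 1 / (64 * (d : ℝ) ^ 3) ≤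
      ∑ i, boolAvg (fun z => (evalBool (g i) z - evalBool (g i) (flipBit j z)) ^ 2)) := by
  classical
  -- the decoupled polynomial and its data (as in `…L1FamilyEquiv.l1Family_of_decoupledCoreAA`)
  set q : MvPolynomial (Fin (N + N)) ℝ := MvPolynomial.C (1 / 2 : ℝ) +
    ∑ i, (MvPolynomial.X (Fin.castAdd N i) - MvPolynomial.C (1 / 2 : ℝ)) *
      MvPolynomial.rename (Fin.natAdd N) (g i) with hq
  set g' : Fin N → (Fin N → Bool) → ℝ := fun i z => 1 / 2 * evalBool (g i) z with hg'
  have hform : ∀ y z : Fin N → Bool,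
      evalBool q (Fin.append y z) = 1 / 2 + ∑ i, (if y i then (1 : ℝ) else -1) * g' i z :=
    fun y z => evalBool_decoupledOf g y z
  have hqdeg : q.totalDegree ≤ d + 1 := totalDegree_decoupledOf_le g hdeg
  have hl1 : ∀ z, ∑ i, |evalBool (g i) z| ≤ 1 := fun z => (sum_abs_eq_one_of_signedPartition g hpart z).le
  have hqb : ∀ x, 0 ≤ evalBool q x ∧ evalBool q x ≤ 1 := decoupledOf_bounded g hl1
  -- `q` is `{0,1}`-valued
  have h01 : ∀ x, evalBool q x = 0 ∨ evalBool q x = 1 := by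
    intro x
    rw [← Fin.append_castAdd_natAdd (f := x), hform]
    have hsq := sum_sign_mul_half_sq g hpart (fun i => x (Fin.castAdd N i)) (fun i => x (Fin.natAdd N i))
    set s := ∑ i, (if x (Fin.castAdd N i) then (1 : ℝ) else -1) * g' i fun i => x (Fin.natAdd N i) with hs
    have hs' : s ^ 2 = 1 / 4 := by rw [hs, hg']; exact hsq
    have : (s - 1 / 2) * (s + 1 / 2) = 0 := by nlinarith [hs']
    rcases mul_eq_zero.mp this with h | h
    · right; linarith
    · left; linarith
  have hPB : PseudoBounded (d + 1) q := pseudoBounded_of_boolean hqdeg h01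
  -- data of the halved family
  obtain ⟨-, hinfy, hinfz, hvar, -⟩ := stub_derivativeFamily N (d + 1) q (1 / 2) g' hform hqdeg hqb
  have hmass : ∀ i, boolAvg (fun z => g' i z ^ 2) = 1 / 4 * boolAvg (fun z => evalBool (g i) z ^ 2) :=
    fun i => boolAvg_half_sq _
  have hdiff : ∀ j i, boolAvg (fun z => (g' i z - g' i (flipBit j z)) ^ 2) =
      1 / 4 * boolAvg (fun z => (evalBool (g i) z - evalBool (g i) (flipBit j z)) ^ 2) := by
    intro j i
    have e : (fun z => (g' i z - g' i (flipBit j z)) ^ 2) =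
        fun z => (1 / 2 * (evalBool (g i) z - evalBool (g i) (flipBit j z))) ^ 2 := by
      funext z; rw [hg']; ring
    rw [e]
    exact boolAvg_half_sq _
  -- `Var q = 1/4`
  have hV : ∑ i, boolAvg (fun z => evalBool (g i) z ^ 2) = 1 := by
    rw [sum_boolAvg_eq]
    simp_rw [sum_sq_eq_one_of_signedPartition g hpart]
    exact boolAvg_const 1
  have hvarq : boolVariance q = 1 / 4 := by
    rw [hvar]
    simp_rw [hmass]
    rw [← Finset.mul_sum, hV, mul_one]
  have hvpos : 0 < boolVariance q := by rw [hvarq]; norm_num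
  -- the Boolean corner
  obtain ⟨j, hj⟩ := exists_influence_ge_of_boolean hPB h01 hvpos
  rw [hvarq] at hj
  have hd1 : (1 : ℝ) ≤ (d : ℝ) := by exact_mod_cast hd
  have hcube : ((d + 1 : ℕ) : ℝ) ^ 3 ≤ 8 * (d : ℝ) ^ 3 := by
    push_cast
    nlinarith [hd1, sq_nonneg ((d : ℝ) - 1), mul_nonneg (sub_nonneg.mpr hd1) (sq_nonneg (d : ℝ))]
  have hInf : 1 / (256 * (d : ℝ) ^ 3) ≤ influence j q := by
    have hI := influence_nonneg j q
    rw [div_le_iff₀ (by positivity)]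
    nlinarith [hj, hcube, hI]
  -- case split on the influential variable
  revert hInf
  refine Fin.addCases (fun i => ?_) (fun j' => ?_) j
  · intro hInf
    left
    refine ⟨i, ?_⟩
    rw [hinfy i, hmass i] at hInf
    linarith
  · intro hInf
    right
    refine ⟨j', ?_⟩
    rw [hinfz j'] at hInf
    simp_rw [hdiff j'] at hInf
    rw [← Finset.mul_sum] at hInf
    have hd3 : (0 : ℝ) < (d : ℝ) ^ 3 := by positivity
    have e : 1 / (64 * (d : ℝ) ^ 3) = 4 * (1 / (256 * (d : ℝ) ^ 3)) := by
      field_simp; ring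
    rw [e]
    linarith

/-! ### §3 The registered statement on the Boolean corner -/

/-- **`stub_l1Family` on the Boolean corner, for every regime.**  The REGISTERED statement of `stub_l1Family` with the
extra hypothesis "`g` is a signed partition of the cube", witnessed by `(c, C) := (3, 1/256)` (the regime hypothesis is
then automatic, `V = 1`, and not used).  The address family of the line card lies here, in alternative (B).
[cite: OdonnellEtAl2005, Thm 1.1] [cite: ODonnellZhao2016, eqn. (2.1) and Thm. 2.13] -/
theorem l1Family_of_signedPartition :
    ∀ (κ₀ : ℕ) (K₀ : ℝ), 0 < K₀ → ∃ (c : ℕ) (C : ℝ), 0 < C ∧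
      ∀ (N d : ℕ) (g : Fin N → MvPolynomial (Fin N) ℝ),
        (∀ z, ∃ i, |evalBool (g i) z| = 1 ∧ ∀ k, k ≠ i → evalBool (g k) z = 0) →
        1 ≤ d → (∀ i, (g i).totalDegree ≤ d) →
        (∀ z, ∑ i, |evalBool (g i) z| ≤ 1) →
        1 ≤ K₀ * (d : ℝ) ^ κ₀ * ∑ i, boolAvg (fun z => evalBool (g i) z ^ 2) →
        (∃ i, C / (d : ℝ) ^ c ≤ boolAvg (fun z => evalBool (g i) z ^ 2)) ∨
        (∃ j, C / (d : ℝ) ^ c ≤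
          ∑ i, boolAvg (fun z => (evalBool (g i) z - evalBool (g i) (flipBit j z)) ^ 2)) := by
  intro κ₀ K₀ _hK₀
  refine ⟨3, 1 / 256, by norm_num, ?_⟩
  intro N d g hpart hd hdeg _hl1 _hreg
  have hd0 : (0 : ℝ) < (d : ℝ) ^ 3 := by
    have : (0 : ℝ) < (d : ℝ) := by exact_mod_cast hd
    positivity
  rcases l1Family_signedPartition g hd hdeg hpart with ⟨i, hi⟩ | ⟨j, hj⟩
  · left
    refine ⟨i, le_trans (le_of_eq ?_) hi⟩
    field_simp
  · right
    refine ⟨j, le_trans ?_ hj⟩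
    rw [div_div]
    apply div_le_div_of_nonneg_left (by norm_num) (by positivity)
    linarith

end Summit.QuantumAdvantage.QuantumAdvantage.Cruxes.DecoupledCoreAA.L1Family.BooleanCorner

end
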